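import Mathlib.GroupTheory.Index
import Mathlib.Algebra.Algebra.Subalgebra.Basic
import Mathlib.RingTheory.Ideal.Defs
import Mathlib.LinearAlgebra.Pi
import Mathlib.Tactic.FieldSimp
import Mathlib.Tactic.LinearCombination
import Mathlib.Tactic.Ring
import HarnessLib

/-!
# Quadratic σ-descent with `2` invertible: `M = M^σ ⊕ δ·M^σ` for a σ-stable module over a ring with involution, the index identity `[Oⁿ : M] = [O_σⁿ : M^σ]²`,
# and the index of a norm fibre (Serre, *Local Fields*, Ch. X §1; Hungerford, *Algebra*, Ch. I §4–§5)

Topic `RingTheory/GaloisAlgebras`; namespace `Literature.RingTheory.GaloisAlgebras`.  THEOREMS ONLY (no definition, no instance, no notation, no named fact, no `sorry`);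
Mathlib-only imports.  Cell `pub/hodgecm-mathlib` (D-0151), crux H413 = `stmt-HodgeConjecture-24833`, road «S3-tree», brick T3′ «DEPTH-ZERO κ-TRANSFER» (holder F0P3b-p01 (g11),
DESIGN v1 419b4e54 §2), organs **O3 «σ-DESCENT»** and **O4 «NORM FIBRE»** (architect A-p16 (g29) deal A-61 (1) ∕ A-62 (1) → A-p19 (g25)).  HONEST LABEL: HC_CM is proved only modulo the
printed citations (2 remaining named inputs hLiu418 24832, h413 24833) until rung 0 closes; this file is generic algebra and asserts nothing printed.

THE MATHEMATICS.  (O3) Let `K` be a field with an involution `σ` (`σ² = id`) preserving a subring `O ≤ K`, with `2⁻¹ ∈ O` and an anti-invariant `δ ∈ O` (`σδ = −δ`, `δ⁻¹ ∈ O`) —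
the situation of an UNRAMIFIED quadratic extension of local fields `E ∕ F` away from `2` (`O = 𝒪_E`, `O_σ := O ∩ K^σ = 𝒪_F`, `δ² ∈ 𝒪_F^×` a non-square unit).  For an `O`-submodule
`M ≤ Kⁿ` stable under COMPONENTWISE `σ` (in T3′: the order `R = 𝒪_E[γ] = span_O{γ^j}` of a norm-one eigenvalue tuple `γ : Fin n → E`, DESIGN §1), every `x ∈ M` is uniquely
`x = y + δz` with `y, z ∈ M^σ := M ∩ (Kⁿ)^σ` (`y = ½(x + σx)`, `z = (2δ)⁻¹(x − σx)`), i.e. `M = M^σ ⊕ δ·M^σ`; applied to `M` and to `Oⁿ` the additive isomorphism `(y, z) ↦ y + δz :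
(O_σⁿ)² ≃ Oⁿ` carries `(M^σ)²` onto `M`, whence **`[Oⁿ : M] = [O_σⁿ : M^σ]²`** (DESIGN §2 O3: `[𝒪_Fⁿ : R^σ]² = [𝒪_Eⁿ : R]`); and the locality clause «every element of `M` is
componentwise congruent to one scalar» passes to `M^σ` with a σ-fixed scalar.  (O4) For a SURJECTIVE homomorphism `N : G → G₀` (in T3′: the componentwise norm `(𝒪_E^×)ⁿ → (𝒪_F^×)ⁿ`,
surjective at an unramified place — ★ `Literature.NumberTheory.LocalFields.UnramifiedQuadraticNormSurjective`) and `V ≤ N⁻¹(U)` (`V = R^×`, `U = R^{σ×}`, `N⁻¹(U) = C = {c : cc^σ ∈ R^×}`):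
`[G : N⁻¹(U)] = [G₀ : U]` and `[N⁻¹(U) : V]·[G₀ : U] = [G : V]`; with O2's two unit indices `[G : V] = (q²−1)^a (q²)^T`, `[G₀ : U] = (q−1)^a q^T` this is **`[C : R^×] = (q+1)^a q^T`**
(`a = n − 1`, `T = S − n + 1`; DESIGN §1: `(q+1)² q^{S−2}` for `n = 3`, `w_S = (q+1)q^{S−1}` for `n = 2`).

* §1 O3: `exists_fixed_add_smul_fixed`, `fixed_add_smul_fixed_unique` (O3 (a)), `relIndex_inf_fixed_sq_eq_relIndex` (O3 (b)), `exists_fixed_scalar_of_fixed` (O3 (c)).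
* §2 O4: `index_comap_eq_of_surjective`, `relIndex_comap_mul_index_eq`, `relIndex_comap_eq_of_index_eq`.

## References
* [Serre1979] J.-P. Serre, *Local Fields*, GTM 67 (1979): Ch. X §1 Prop. 3 (Galois descent for vector spaces; here the quadratic case over a ring with `2` invertible), Ch. V §2 Prop. 3
  (norms of units in the unramified case).
* [Hungerford1974] T. W. Hungerford, *Algebra*, GTM 73 (1974): Ch. I Thm. 4.5 (Lagrange: `[G:H][H:K] = [G:K]`), Thm. 5.11 ∕ Cor. 5.12 (correspondence under a surjection).
* [Rogawski1990] J. D. Rogawski, *Automorphic Representations of Unitary Groups in Three Variables* (1990): §4.9 Lemma 4.9.3 p. 56 (where the count is consumed).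
-/

set_option autoImplicit false

namespace Literature.RingTheory.GaloisAlgebras

open Function

/-! ## §1 O3 — quadratic σ-descent for a σ-stable `O`-submodule of `Kⁿ` -/

section SigmaDescent

variable {K : Type*} [Field K] (σ : K →+* K) (O : Subring K) {n : ℕ}

/-- A unit of the subring `O ≤ K` is non-zero in `K` and has its inverse in `O`. [cite: Hungerford1974, Ch. III §1] -/
theorem coe_ne_zero_and_inv_mem_of_isUnit {a : O} (ha : IsUnit a) : (a : K) ≠ 0 ∧ (a : K)⁻¹ ∈ O := by
  obtain ⟨u, rfl⟩ := ha
  have hmul : ((u : O) : K) * ((u⁻¹ : Oˣ) : O) = 1 := by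
    rw [← Subring.coe_mul, Units.mul_inv, Subring.coe_one]
  have hne : ((u : O) : K) ≠ 0 := fun h0 => by
    rw [h0, zero_mul] at hmul
    exact zero_ne_one hmul
  refine ⟨hne, ?_⟩
  rw [inv_eq_of_mul_eq_one_right hmul]
  exact ((u⁻¹ : Oˣ) : O).2

/-- **O3 (a), EXISTENCE: `x = y + δ•z` with `y, z ∈ M` componentwise σ-fixed** (`y = ½(x + σx)`, `z = (2δ)⁻¹(x − σx)`), for `M ≤ Kⁿ` an `O`-submodule stable under
componentwise `σ`, `σ² = id`, `2 ∈ O^×`, `δ ∈ O^×` with `σδ = −δ` (the consumer's tokens `IsUnit (2 : O)`, `IsUnit δ`). [cite: Serre1979, Ch. X §1 Prop. 3] -/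
theorem exists_fixed_add_smul_fixed (hσσ : ∀ a, σ (σ a) = a) (h2 : IsUnit (2 : O))
    (δ : O) (hδ : IsUnit δ) (hσδ : σ (δ : K) = -(δ : K))
    (M : Submodule O (Fin n → K)) (hM : ∀ x ∈ M, (fun i => σ (x i)) ∈ M) (x : Fin n → K) (hx : x ∈ M) :
    ∃ y z : Fin n → K, y ∈ M ∧ z ∈ M ∧ (∀ i, σ (y i) = y i) ∧ (∀ i, σ (z i) = z i) ∧ x = y + (δ : K) • z := by
  obtain ⟨h20, h2'⟩ := coe_ne_zero_and_inv_mem_of_isUnit O h2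
  have e2 : ((2 : O) : K) = 2 := map_ofNat O.subtype 2
  rw [e2] at h20 h2'
  obtain ⟨hδ0, hδ'⟩ := coe_ne_zero_and_inv_mem_of_isUnit O hδ
  have hσ2 : σ (2 : K)⁻¹ = (2 : K)⁻¹ := by rw [map_inv₀, map_ofNat]
  have hσδ' : σ (δ : K)⁻¹ = -(δ : K)⁻¹ := by rw [map_inv₀, hσδ, neg_inv]
  refine ⟨fun i => (2 : K)⁻¹ * (x i + σ (x i)), fun i => (2 : K)⁻¹ * (δ : K)⁻¹ * (x i - σ (x i)), ?_, ?_, ?_, ?_, ?_⟩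
  · -- `y = 2⁻¹ • (x + σx) ∈ M`
    have h : (fun i => (2 : K)⁻¹ * (x i + σ (x i))) = (⟨(2 : K)⁻¹, h2'⟩ : O) • (x + fun i => σ (x i)) := by
      funext i; rfl
    rw [h]
    exact M.smul_mem _ (M.add_mem hx (hM x hx))
  · -- `z = (2⁻¹ δ⁻¹) • (x − σx) ∈ M`
    have h : (fun i => (2 : K)⁻¹ * (δ : K)⁻¹ * (x i - σ (x i))) = (⟨(2 : K)⁻¹ * (δ : K)⁻¹, O.mul_mem h2' hδ'⟩ : O) • (x - fun i => σ (x i)) := by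
      funext i; rfl
    rw [h]
    exact M.smul_mem _ (M.sub_mem hx (hM x hx))
  · intro i
    simp only [map_mul, map_add, hσσ, hσ2]
    ring
  · intro i
    simp only [map_mul, map_sub, hσσ, hσ2, hσδ']
    ring
  · funext i
    simp only [Pi.add_apply, Pi.smul_apply, smul_eq_mul]
    have hδδ : (δ : K) * (δ : K)⁻¹ = 1 := mul_inv_cancel₀ hδ0
    have h22 : (2 : K)⁻¹ * 2 = 1 := inv_mul_cancel₀ h20
    linear_combination (-(2 : K)⁻¹ * (x i - σ (x i))) * hδδ - (x i) * h22

/-- **O3 (a), UNIQUENESS**: `y + δ•z = y′ + δ•z′` with `y, z, y′, z′` componentwise σ-fixed forces `y = y′`, `z = z′` (apply `σ` and subtract; `2δ ≠ 0`).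
[cite: Serre1979, Ch. X §1 Prop. 3] -/
theorem fixed_add_smul_fixed_unique (h20 : (2 : K) ≠ 0) {δ : K} (hδ0 : δ ≠ 0) (hσδ : σ δ = -δ)
    {y z y' z' : Fin n → K} (hy : ∀ i, σ (y i) = y i) (hz : ∀ i, σ (z i) = z i) (hy' : ∀ i, σ (y' i) = y' i) (hz' : ∀ i, σ (z' i) = z' i)
    (h : y + δ • z = y' + δ • z') : y = y' ∧ z = z' := by
  have hpt : ∀ i, y i + δ * z i = y' i + δ * z' i := fun i => by
    have := congrFun h i
    simpa only [Pi.add_apply, Pi.smul_apply, smul_eq_mul] using this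
  have hσpt : ∀ i, y i - δ * z i = y' i - δ * z' i := fun i => by
    have := congrArg σ (hpt i)
    rw [map_add, map_add, map_mul, map_mul, hy, hz, hy', hz', hσδ] at this
    linear_combination this
  have hzz : ∀ i, z i = z' i := fun i => by
    have h1 := hpt i
    have h2 := hσpt i
    have : (2 * δ) * (z i - z' i) = 0 := by linear_combination h1 - h2
    rcases mul_eq_zero.1 this with h0 | h0
    · exact absurd h0 (mul_ne_zero h20 hδ0)
    · exact sub_eq_zero.1 h0
  refine ⟨funext fun i => ?_, funext hzz⟩
  have h1 := hpt i
  rw [hzz i] at h1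
  exact add_right_cancel h1

/-- **O3 (b) THE INDEX SQUARES: `[Oⁿ : M] = [O_σⁿ : M^σ]²`.**  Tokens: `Oⁿ := AddSubgroup.pi univ (fun _ ↦ O)`, `Fix := eqLocus (componentwise σ) id` (so `Oⁿ ⊓ Fix = O_σⁿ`,
`M ⊓ Fix = M^σ`); indices are `AddSubgroup.relIndex` in `Kⁿ` (`0` when infinite).  The additive isomorphism `(y, z) ↦ y + δ•z : O_σⁿ × O_σⁿ → Oⁿ` (onto by O3 (a) for `Oⁿ`,
injective by uniqueness) pulls `M` back to `M^σ × M^σ` (O3 (a) for `M` + uniqueness), and the index of a product is the product of the indices (no `M ≤ Oⁿ` needed: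
both sides intersect with `Oⁿ` resp. `O_σⁿ`).
At `O = 𝒪_E`, `O_σ = 𝒪_F`, `M = R`: `[𝒪_Fⁿ : R^σ]² = [𝒪_Eⁿ : R]`. [cite: Serre1979, Ch. X §1 Prop. 3] [cite: Hungerford1974, Ch. I Thm. 4.5, Thm. 5.11] -/
theorem relIndex_inf_fixed_sq_eq_relIndex (hσσ : ∀ a, σ (σ a) = a) (hσO : ∀ a ∈ O, σ a ∈ O) (h2 : IsUnit (2 : O))
    (δ : O) (hδ : IsUnit δ) (hσδ : σ (δ : K) = -(δ : K))
    (M : Submodule O (Fin n → K)) (hM : ∀ x ∈ M, (fun i => σ (x i)) ∈ M) :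
    ((M.toAddSubgroup ⊓ (RingHom.eqLocus (RingHom.pi (fun i => σ.comp (Pi.evalRingHom (fun _ : Fin n => K) i))) (RingHom.id (Fin n → K))).toAddSubgroup).relIndex
        ((AddSubgroup.pi Set.univ fun _ : Fin n => O.toAddSubgroup) ⊓
          (RingHom.eqLocus (RingHom.pi (fun i => σ.comp (Pi.evalRingHom (fun _ : Fin n => K) i))) (RingHom.id (Fin n → K))).toAddSubgroup)) ^ 2 =
      M.toAddSubgroup.relIndex (AddSubgroup.pi Set.univ fun _ : Fin n => O.toAddSubgroup) := by
  classical
  obtain ⟨h20, h2'⟩ := coe_ne_zero_and_inv_mem_of_isUnit O h2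
  have e2 : ((2 : O) : K) = 2 := map_ofNat O.subtype 2
  rw [e2] at h20 h2'
  obtain ⟨hδ0, hδ'⟩ := coe_ne_zero_and_inv_mem_of_isUnit O hδ
  -- names
  set Fix : AddSubgroup (Fin n → K) :=
    (RingHom.eqLocus (RingHom.pi (fun i => σ.comp (Pi.evalRingHom (fun _ : Fin n => K) i))) (RingHom.id (Fin n → K))).toAddSubgroup with hFix
  set On : AddSubgroup (Fin n → K) := AddSubgroup.pi Set.univ fun _ : Fin n => O.toAddSubgroup with hOn
  set P : AddSubgroup (Fin n → K) := On ⊓ Fix with hP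
  set Mσ : AddSubgroup (Fin n → K) := M.toAddSubgroup ⊓ Fix with hMσ
  have memFix : ∀ x : Fin n → K, x ∈ Fix ↔ ∀ i, σ (x i) = x i := fun x => by
    rw [hFix, Subring.mem_toAddSubgroup, RingHom.mem_eqLocus]
    exact ⟨fun h i => by simpa using congrFun h i, fun h => funext fun i => by simpa using h i⟩
  have memOn : ∀ x : Fin n → K, x ∈ On ↔ ∀ i, x i ∈ O := fun x => by
    rw [hOn, AddSubgroup.mem_pi]; simp
  -- the decomposition inside `Oⁿ`
  have hσ2 : σ (2 : K)⁻¹ = (2 : K)⁻¹ := by rw [map_inv₀, map_ofNat]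
  have hσδ' : σ (δ : K)⁻¹ = -(δ : K)⁻¹ := by rw [map_inv₀, hσδ, neg_inv]
  have decO : ∀ x ∈ On, ∃ y z : Fin n → K, y ∈ P ∧ z ∈ P ∧ x = y + (δ : K) • z := by
    intro x hx
    rw [memOn] at hx
    refine ⟨fun i => (2 : K)⁻¹ * (x i + σ (x i)), fun i => (2 : K)⁻¹ * (δ : K)⁻¹ * (x i - σ (x i)), ?_, ?_, ?_⟩
    · rw [hP, AddSubgroup.mem_inf, memOn, memFix]
      exact ⟨fun i => O.mul_mem h2' (O.add_mem (hx i) (hσO _ (hx i))), fun i => by simp only [map_mul, map_add, hσσ, hσ2]; ring⟩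
    · rw [hP, AddSubgroup.mem_inf, memOn, memFix]
      exact ⟨fun i => O.mul_mem (O.mul_mem h2' hδ') (O.sub_mem (hx i) (hσO _ (hx i))), fun i => by simp only [map_mul, map_sub, hσσ, hσ2, hσδ']; ring⟩
    · funext i
      simp only [Pi.add_apply, Pi.smul_apply, smul_eq_mul]
      have hδδ : (δ : K) * (δ : K)⁻¹ = 1 := mul_inv_cancel₀ hδ0
      have h22 : (2 : K)⁻¹ * 2 = 1 := inv_mul_cancel₀ h20
      linear_combination (-(2 : K)⁻¹ * (x i - σ (x i))) * hδδ - (x i) * h22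
  -- the restricted isomorphism `Ψ : P × P →+ On`, `(y, z) ↦ y + δ z`
  have hPO : ∀ y ∈ P, ∀ z ∈ P, y + (δ : K) • z ∈ On := by
    intro y hy z hz
    rw [hP, AddSubgroup.mem_inf, memOn] at hy hz
    rw [memOn]
    intro i
    simp only [Pi.add_apply, Pi.smul_apply, smul_eq_mul]
    exact O.add_mem (hy.1 i) (O.mul_mem δ.2 (hz.1 i))
  let Ψ : ↥P × ↥P →+ ↥On :=
    { toFun := fun yz => ⟨(yz.1 : Fin n → K) + (δ : K) • (yz.2 : Fin n → K), hPO _ yz.1.2 _ yz.2.2⟩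
      map_zero' := by ext i; simp
      map_add' := fun a b => by
        ext i
        simp only [Prod.fst_add, Prod.snd_add, AddSubgroup.coe_add, Pi.add_apply, Pi.smul_apply, smul_eq_mul, smul_add]
        ring }
  have hΨ : ∀ yz : ↥P × ↥P, ((Ψ yz : ↥On) : Fin n → K) = (yz.1 : Fin n → K) + (δ : K) • (yz.2 : Fin n → K) := fun _ => rfl
  have hΨsurj : Function.Surjective Ψ := by
    rintro ⟨x, hx⟩
    obtain ⟨y, z, hy, hz, hxyz⟩ := decO x hx
    exact ⟨(⟨y, hy⟩, ⟨z, hz⟩), Subtype.ext (by rw [hΨ]; exact hxyz.symm)⟩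
  -- `Ψ⁻¹(M) = Mσ × Mσ`
  have hfixP : ∀ y : Fin n → K, y ∈ P → ∀ i, σ (y i) = y i := fun y hy => by
    rw [hP, AddSubgroup.mem_inf, memFix] at hy
    exact hy.2
  have hcomap : (M.toAddSubgroup.addSubgroupOf On).comap Ψ = (Mσ.addSubgroupOf P).prod (Mσ.addSubgroupOf P) := by
    ext yz
    rw [AddSubgroup.mem_comap, AddSubgroup.mem_addSubgroupOf, hΨ, AddSubgroup.mem_prod, AddSubgroup.mem_addSubgroupOf, AddSubgroup.mem_addSubgroupOf,
      hMσ, AddSubgroup.mem_inf, AddSubgroup.mem_inf, Submodule.mem_toAddSubgroup, Submodule.mem_toAddSubgroup, Submodule.mem_toAddSubgroup, memFix, memFix]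
    constructor
    · intro h
      obtain ⟨y', z', hy', hz', hfy', hfz', hdec⟩ := exists_fixed_add_smul_fixed σ O hσσ h2 δ hδ hσδ M hM _ h
      obtain ⟨hyy, hzz⟩ := fixed_add_smul_fixed_unique σ h20 hδ0 hσδ (hfixP _ yz.1.2) (hfixP _ yz.2.2) hfy' hfz' hdec
      exact ⟨⟨hyy ▸ hy', hfixP _ yz.1.2⟩, ⟨hzz ▸ hz', hfixP _ yz.2.2⟩⟩
    · rintro ⟨⟨hy, -⟩, ⟨hz, -⟩⟩
      have h := M.add_mem hy (M.smul_mem δ hz)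
      exact h
  -- indices
  have h1 : M.toAddSubgroup.relIndex On = (M.toAddSubgroup.addSubgroupOf On).index := rfl
  have h2' : Mσ.relIndex P = (Mσ.addSubgroupOf P).index := rfl
  rw [h1, h2', ← AddSubgroup.index_comap_of_surjective (M.toAddSubgroup.addSubgroupOf On) hΨsurj, hcomap, AddSubgroup.index_prod, sq]

/-- **O3 (c) «LOCAL WITH RESIDUE FIELD `k_F`» TRANSFERS TO `M^σ`**: if every `x ∈ M` is componentwise congruent to ONE scalar `c ∈ O` modulo a σ-stable ideal `I` of `O`
(`x i = c + t_i`, `t_i ∈ I`: the locality of the order `O[γ]` near `1` — all eigenvalues share a residue), then a componentwise σ-fixed `x ∈ M` is congruent to one σ-FIXED scalar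
(`c ↦ ½(c + σc)`, `t_i ↦ ½(t_i + σ t_i)`). [cite: Serre1979, Ch. X §1] -/
theorem exists_fixed_scalar_of_fixed (hσO : ∀ a ∈ O, σ a ∈ O) (hσσ : ∀ a, σ (σ a) = a) (h2 : IsUnit (2 : O))
    (I : Ideal O) (hI : ∀ a : O, a ∈ I → (⟨σ a, hσO a a.2⟩ : O) ∈ I)
    (M : Submodule O (Fin n → K)) (hloc : ∀ x ∈ M, ∃ c : O, ∀ i, ∃ t ∈ I, x i = (c : K) + (t : K))
    (x : Fin n → K) (hx : x ∈ M) (hfix : ∀ i, σ (x i) = x i) :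
    ∃ c : O, σ c = c ∧ ∀ i, ∃ t ∈ I, x i = (c : K) + (t : K) := by
  obtain ⟨h20, h2'⟩ := coe_ne_zero_and_inv_mem_of_isUnit O h2
  have e2 : ((2 : O) : K) = 2 := map_ofNat O.subtype 2
  rw [e2] at h20 h2'
  obtain ⟨c, hc⟩ := hloc x hx
  have hσ2 : σ (2 : K)⁻¹ = (2 : K)⁻¹ := by rw [map_inv₀, map_ofNat]
  have h22 : (2 : K)⁻¹ * 2 = 1 := inv_mul_cancel₀ h20
  refine ⟨⟨(2 : K)⁻¹, h2'⟩ * (c + ⟨σ c, hσO c c.2⟩), ?_, fun i => ?_⟩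
  · simp only [Subring.coe_mul, Subring.coe_add, map_mul, map_add, hσ2, hσσ]
    ring
  · obtain ⟨t, ht, hxt⟩ := hc i
    refine ⟨⟨(2 : K)⁻¹, h2'⟩ * (t + ⟨σ t, hσO t t.2⟩), I.mul_mem_left _ (I.add_mem ht (hI t ht)), ?_⟩
    have hσx : x i = σ (c : K) + σ (t : K) := by rw [← map_add, ← hxt, hfix]
    simp only [Subring.coe_mul, Subring.coe_add]
    linear_combination (2 : K)⁻¹ * hxt + (2 : K)⁻¹ * hσx - (x i) * h22

end SigmaDescent

/-! ## §2 O4 — the index of a norm fibre -/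

section NormFibre

variable {G G₀ : Type*} [Group G] [Group G₀]

/-- **O4 (a) `[G : N⁻¹(U)] = [G₀ : U]` for a SURJECTIVE hom `N`** (Mathlib `Subgroup.index_comap_of_surjective`).  In T3′: `N` = componentwise norm `(𝒪_E^×)ⁿ → (𝒪_F^×)ⁿ`
(surjective at an unramified place, ★ `UnramifiedQuadraticNormSurjective`), `U = R^{σ×}`, `N⁻¹(U) = C`. [cite: Hungerford1974, Ch. I Thm. 5.11, Cor. 5.12] -/
theorem index_comap_eq_of_surjective (N : G →* G₀) (hN : Surjective N) (U : Subgroup G₀) : (U.comap N).index = U.index :=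
  Subgroup.index_comap_of_surjective U hN

/-- **O4 (b) `[N⁻¹(U) : V] · [G₀ : U] = [G : V]`** for `V ≤ N⁻¹(U)` (in T3′: `V = R^× ≤ C`, since `N(R^×) ⊆ R ∩ (𝒪_F^×)ⁿ = R^{σ×}`).
[cite: Hungerford1974, Ch. I Thm. 4.5, Thm. 5.11] -/
theorem relIndex_comap_mul_index_eq (N : G →* G₀) (hN : Surjective N) (U : Subgroup G₀) (V : Subgroup G) (hV : V ≤ U.comap N) :
    V.relIndex (U.comap N) * U.index = V.index := by
  rw [← Subgroup.index_comap_of_surjective U hN]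
  exact Subgroup.relIndex_mul_index hV

/-- **O4 (c) THE COUNT `[C : R^×] = (q+1)^a q^T`** from the two unit indices of O2 (`[G : V] = (q²−1)^a (q²)^T` at `q_E = q²`, `[G₀ : U] = (q−1)^a q^T`; `a = n − 1`,
`T = S − n + 1` free naturals) and O4 (a)(b): `(q+1)^a q^T · (q−1)^a q^T = (q²−1)^a (q²)^T`, cancel (`q ≥ 2`).  DESIGN §1: `(q+1)² q^{S−2}` (`n = 3`), `w_S = (q+1) q^{S−1}` (`n = 2`).
[cite: Rogawski1990, §4.9 Lemma 4.9.3 p. 56] [cite: Hungerford1974, Ch. I Thm. 4.5] -/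
theorem relIndex_comap_eq_of_index_eq (N : G →* G₀) (hN : Surjective N) (U : Subgroup G₀) (V : Subgroup G) (hV : V ≤ U.comap N)
    {q a T : ℕ} (hq : 2 ≤ q) (hVi : V.index = (q ^ 2 - 1) ^ a * (q ^ 2) ^ T) (hUi : U.index = (q - 1) ^ a * q ^ T) :
    V.relIndex (U.comap N) = (q + 1) ^ a * q ^ T := by
  have h := relIndex_comap_mul_index_eq N hN U V hV
  rw [hVi, hUi] at h
  have hpos : 0 < (q - 1) ^ a * q ^ T := Nat.pos_of_ne_zero (mul_ne_zero (pow_ne_zero _ (by omega)) (pow_ne_zero _ (by omega)))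
  refine Nat.eq_of_mul_eq_mul_right hpos ?_
  rw [h]
  have hsq : q ^ 2 - 1 = (q + 1) * (q - 1) := by
    have := Nat.sq_sub_sq q 1
    simpa using this
  rw [hsq, mul_pow]
  ring

end NormFibre

end Literature.RingTheory.GaloisAlgebras
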